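/-
Copyright (c) 2026. All rights reserved.
Released under Apache 2.0 license as described in the file LICENSE.
Authors: abc-iut cell, prover seat abc-iut-w5-d017 (wave 5, gen 5).
-/
import Literature.IUT.LogThetaLattice.LogLinkIteratesWildPrime
import Literature.IUT.LogVolume.UnitLogRamificationCriterion
import HarnessLib

/-!
# [IUTchIII] Rmk 1.1.1 (i): the iterate domains of the log-link at ODD `p` — `D_2 = ∅ ⟺ p ∤ e`

Mochizuki, *Inter-universal Teichmüller Theory III*, RIMS preprint (kurims ms, p. 28), Remark 1.1.1 (i)
(record only): "the various iterates of the log-link are defined only on the [local] units that appear in the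
domains of these iterates".  abc-iut-L6-t3/L6-d2 typed the domain `D_n` of the `n`-th iterate (`iterDomain`:
`D_0 = k`, `D_{n+1} = {x ∈ 𝒪_k^× | log_k x ∈ D_n}`) over abc-iut-L4-t3's `PadicLogOnUnits`, and
`LogLinkIteratesUnramified.lean` / `LogLinkIteratesWildPrime.lean` (abc-iut-w5-d138) decided `D_2` for the
standard model `ofUnitLog p K` (abc-iut-S1's `unitLog`) in the cases `e(K/ℚ_p) ≤ p − 1` (`D_{n+2} = ∅`) and
`πᵖ = p ∈ K` (`D_n ∋ 1 + π` for all `n`).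

THIS FILE (proof-only, no definitions) reads abc-iut-w5-d017's ramification criterion
(`UnitLogRamificationCriterion.lean`: for odd `p`, `log_p(𝒪_K^×)` meets `𝒪_K^×` iff `p ∣ e(K/ℚ_p)`; for every
`p`, `p ∤ e ⇒` it does not) in this vocabulary:

* `iterDomain_ofUnitLog_add_two_eq_empty_of_not_dvd` — **`p ∤ e(K/ℚ_p)` (any `p`) ⇒ `D_{n+2} = ∅`**;
* `iterDomain_ofUnitLog_two_nonempty_of_dvd` — **`p` odd, `p ∣ e` ⇒ `D_2 ≠ ∅`** (`1 − ϖ^{e/p} ∈ D_2`);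
* `iterDomain_ofUnitLog_two_eq_empty_iff_not_dvd` — **`p` odd: `D_2 = ∅ ⟺ p ∤ e(K/ℚ_p)`**.

Honest framing: a statement about the standard MODEL of the local units and their logarithm; record-only
w.r.t. [IUTchIII]; nothing here bears on [IUTchIII] Cor. 3.12; no side taken.
-/

noncomputable section

open Set Metric

namespace Literature.IUT.LogThetaLattice

open Literature.IUT.LogVolume Literature.AnabelianGeometry.AbsoluteAnabelian

variable (p : ℕ) [hp : Fact p.Prime]
variable {K : Type*} [NontriviallyNormedField K] [instK : NormedAlgebra ℚ_[p] K] [IsUltrametricDist K]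
  [ProperSpace K]

/-! ### `p ∤ e`: every iterate beyond the first has empty domain -/

/-- **IUTchIII:Rmk1.1.1(i)** (kurims p.28) at a place with `p ∤ e(K/ℚ_p)` (every prime `p`; at `p = 2`: odd `e`):
the domain `D_2` of the second iterate of the log-link on the units is EMPTY for the standard model
`ofUnitLog p K` — no unit has a unit logarithm (abc-iut-w5-d017's
`RamificationCriterion.norm_unitLog_ne_one_of_not_dvd`). [claim: Mochizuki2012, status: disputed] -/
theorem iterDomain_ofUnitLog_two_eq_empty_of_not_dvd (he : ¬ p ∣ absRamificationIdx p K) :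
    iterDomain (PadicLogOnUnits.ofUnitLog p K) 2 = ∅ := by
  ext x
  simp only [mem_iterDomain_succ, iterDomain_zero, mem_univ, and_true, mem_empty_iff_false, iff_false,
    not_and]
  intro _ hlx
  rw [mem_sphere_zero_iff_norm, PadicLogOnUnits.ofUnitLog_log] at hlx
  exact RamificationCriterion.norm_unitLog_ne_one_of_not_dvd p he x hlx

/-- … hence `D_{n+2} = ∅` for every `n` when `p ∤ e`. [claim: Mochizuki2012, status: disputed] -/
theorem iterDomain_ofUnitLog_add_two_eq_empty_of_not_dvd (he : ¬ p ∣ absRamificationIdx p K) (n : ℕ) :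
    iterDomain (PadicLogOnUnits.ofUnitLog p K) (n + 2) = ∅ := by
  induction n with
  | zero => exact iterDomain_ofUnitLog_two_eq_empty_of_not_dvd p he
  | succ n ih =>
    exact eq_empty_of_subset_empty (ih ▸ iterDomain_succ_subset (PadicLogOnUnits.ofUnitLog p K) (n + 2))

/-- … and every image `log^{[n+2]}(D_{n+2})` is empty there. [claim: Mochizuki2012, status: disputed] -/
theorem iterate_image_ofUnitLog_eq_empty_of_not_dvd (he : ¬ p ∣ absRamificationIdx p K) (n : ℕ) :
    ((PadicLogOnUnits.ofUnitLog p K).log^[n + 2]) '' iterDomain (PadicLogOnUnits.ofUnitLog p K) (n + 2)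
      = ∅ := by
  rw [iterDomain_ofUnitLog_add_two_eq_empty_of_not_dvd p he n, image_empty]

/-! ### `p` odd, `p ∣ e`: the second iterate has inhabited domain -/

/-- **IUTchIII:Rmk1.1.1(i)** (kurims p.28) at a place with `p` ODD and `p ∣ e(K/ℚ_p)`: the domain `D_2` of the
second iterate is INHABITED for the standard model (the unit `1 − ϖ^{e/p}` has a unit logarithm,
abc-iut-w5-d017's `RamificationCriterion.exists_norm_unitLog_eq_one_of_dvd`).
[claim: Mochizuki2012, status: disputed] -/
theorem iterDomain_ofUnitLog_two_nonempty_of_dvd (hp2 : p ≠ 2) (he : p ∣ absRamificationIdx p K) :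
    (iterDomain (PadicLogOnUnits.ofUnitLog p K) 2).Nonempty := by
  obtain ⟨u, hu, hlog⟩ := RamificationCriterion.exists_norm_unitLog_eq_one_of_dvd p hp2 he
  refine ⟨u, ?_⟩
  simp only [mem_iterDomain_succ, iterDomain_zero, mem_univ, and_true, mem_sphere_zero_iff_norm,
    PadicLogOnUnits.ofUnitLog_log]
  exact ⟨hu, hlog⟩

/-! ### The criterion at odd `p` -/

/-- **IUTchIII:Rmk1.1.1(i)** (kurims p.28), standard model, `p` ODD: **`D_2 ≠ ∅ ⟺ p ∣ e(K/ℚ_p)`**.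
[claim: Mochizuki2012, status: disputed] -/
theorem iterDomain_ofUnitLog_two_nonempty_iff_dvd (hp2 : p ≠ 2) :
    (iterDomain (PadicLogOnUnits.ofUnitLog p K) 2).Nonempty ↔ p ∣ absRamificationIdx p K := by
  refine ⟨fun h ↦ ?_, iterDomain_ofUnitLog_two_nonempty_of_dvd p hp2⟩
  by_contra he
  rw [iterDomain_ofUnitLog_two_eq_empty_of_not_dvd p he] at h
  exact Set.not_nonempty_empty h

/-- **IUTchIII:Rmk1.1.1(i)** (kurims p.28), standard model, `p` ODD: **`D_2 = ∅ ⟺ p ∤ e(K/ℚ_p)`** — the second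
(hence every higher) iterate of the log-link on the units has empty domain exactly when `p` does not divide
the absolute ramification index. [claim: Mochizuki2012, status: disputed] -/
theorem iterDomain_ofUnitLog_two_eq_empty_iff_not_dvd (hp2 : p ≠ 2) :
    iterDomain (PadicLogOnUnits.ofUnitLog p K) 2 = ∅ ↔ ¬ p ∣ absRamificationIdx p K := by
  rw [← Set.not_nonempty_iff_eq_empty, iterDomain_ofUnitLog_two_nonempty_iff_dvd p hp2]

/-- … all higher domains too: `(∀ n, D_{n+2} = ∅) ⟺ p ∤ e` (`p` odd). [claim: Mochizuki2012, status: disputed] -/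
theorem forall_iterDomain_ofUnitLog_add_two_eq_empty_iff_not_dvd (hp2 : p ≠ 2) :
    (∀ n : ℕ, iterDomain (PadicLogOnUnits.ofUnitLog p K) (n + 2) = ∅) ↔ ¬ p ∣ absRamificationIdx p K := by
  refine ⟨fun h ↦ ?_, fun he n ↦ iterDomain_ofUnitLog_add_two_eq_empty_of_not_dvd p he n⟩
  rw [← iterDomain_ofUnitLog_two_eq_empty_iff_not_dvd p hp2]
  exact h 0

end Literature.IUT.LogThetaLattice

end
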